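import Summits.QuantumFields.YangMills.Theorems.AllWindowsColdBoxBoxHighLineRestrictionSetMoments
import Summits.QuantumFields.YangMills.Theorems.AllWindowsColdBoxBoxHighLineRestrictionSetCum4Prelims
import Summits.QuantumFields.YangMills.Theorems.AllWindowsColdBoxBoxHighLineTiltThirdOrder

/-!
# U5 ε₂-glue (G2c-3b): the D-truncation transfer `μ_{D′} ↔ E₀` for the FOURTH cumulant at `t = 0` (general measurable `D′`, eighth-moment hypotheses)

Free-hands helper of the κ-lineage (ym-line-fcl-p3 g27) for Steps D–E of the NEXT rung U5 (`stub_landauThirdOrder`, LINE-20, ⟨stmt-QuantumFields-24336⟩).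
Planner ym-idea-2 g18's `ASSEMBLY-U5.md` v0.1 §3: `f″(0)/2 = κ₄,₀(c₀, c_T; U, U)/2` over `μ_{D′}` on the CUT small field, its connected cubic-pair term evaluated
EXACTLY by Wick under the FULL Gaussian (L3c, LEAD ym-line-sfw-p2 g78 «ConnectedFourPoint»: `E₀[L̃₀L̃_T·P²] − E₀[L̃₀L̃_T]·E₀[P²]`).  Between the two sits the
D′-truncation transfer of `κ₄,₀`, supplied here for an ARBITRARY measurable `D ⊆ (LandauFree H → E3)` (indicator `D.indicator (fun _ => 1)`;
`μ_D := (volume.restrict D).withDensity (ofReal ∘ gaussWeight β H)`; `sfInd H s`/`smallField H s` is the instance by `rfl`):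

* ★★ `abs_tiltCum4_muSet_zero_sub_gaussCum4_le` — `E₀[1 − 1_D] ≤ τ ≤ 1/2`; `G₁, G₂, P` measurable, bounded by `B` on `D`, EIGHTH moments under `E₀`
  (so POLYNOMIAL slots are admissible); raw second-moment sizes `A_V ≥ E₀[V²]` for the eleven monomials of ✓`Tilt.tiltCum4_eq_raw`:
  `|Tilt.tiltCum4 μ_D P 0 G₁ G₂ − RAW₁₁(E₀; G₁, G₂, P)| ≤ √τ·(4√A₁₂₃₃ + 24√A₃√A₁₂₃ + 56·A₃…)` (the explicit eleven-term polynomial of ✓`cum4_transfer_arith` in the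
  square roots `√A_V`), where `RAW₁₁(E₀)` is ✓`Tilt.tiltCum4_eq_raw`'s right-hand side with every `E_t` replaced by `gaussAvg β H`;
* `tiltCum4_muSet_zero_shift` (re-centring of all three letters over `μ_D`) and ★★ `abs_tiltCum4_muSet_zero_sub_gaussAvg_centred_le`: the same bound
  against the CENTRED form `E₀[X̃ỸZ̃²] − E₀[X̃Ỹ]·E₀[Z̃²] − 2·E₀[X̃Z̃]·E₀[ỸZ̃]` (`X̃ = G₁ − E₀G₁`, `Ỹ = G₂ − E₀G₂`, `Z̃ = P − E₀P`) — LEAD's C4 shape plus the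
  term `2·E₀[X̃Z̃]·E₀[ỸZ̃]` that parity kills when `P` is odd and the `Gᵢ` are even.
With ✓6g + ✓`GaussianPolyTail` (`τ″ = τ + cubic tail`) and polynomial sizes the transfer error is `e^{−cβ^{2κ₃}/2}`-small on U5's window.

No definitions; standard axioms.  HONEST LABEL: helper-grade glue for U5 prep; U5, ⟨24004⟩, ⟨24336⟩ remain OPEN; route AllWindowsColdBox is DRAFT;
no crux, rung or summit is proved; the Yang–Mills mass gap is NOT proved by this file; no summit is proved by a line.
-/

set_option autoImplicit false

noncomputable section

open MeasureTheory Set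

namespace Summit.QuantumFields.YangMills.Theorems.AllWindowsColdBoxBoxHighLine

namespace GaussRestrict

variable {H : ℕ} {β : ℝ}

/-! ## The fourth-cumulant transfer `μ_D ↔ E₀` for a general measurable `D` -/

/-- ★★ **D-TRUNCATION TRANSFER FOR `κ₄,₀`** (raw form).  See the module docstring. -/
theorem abs_tiltCum4_muSet_zero_sub_gaussCum4_le (hβ : 0 < β) {D : Set (LandauFree H → E3)} (hDm : MeasurableSet D) {τ : ℝ}
    (hτ : gaussAvg β H (fun a => 1 - D.indicator (fun _ => (1 : ℝ)) a) ≤ τ) (hτ2 : τ ≤ 1 / 2)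
    {G₁ G₂ P : (LandauFree H → E3) → ℝ} (h₁ : Measurable G₁) (h₂ : Measurable G₂) (hP : Measurable P) {B : ℝ} (hB : 0 ≤ B)
    (h₁D : ∀ a ∈ D, |G₁ a| ≤ B) (h₂D : ∀ a ∈ D, |G₂ a| ≤ B) (hPD : ∀ a ∈ D, |P a| ≤ B)
    (i₁ : Integrable (fun a => G₁ a ^ 8 * gaussWeight β H a)) (i₂ : Integrable (fun a => G₂ a ^ 8 * gaussWeight β H a))
    (iP : Integrable (fun a => P a ^ 8 * gaussWeight β H a))
    {A₁ A₂ A₃ A₁₂ A₁₃ A₂₃ A₃₃ A₁₂₃ A₁₃₃ A₂₃₃ A₁₂₃₃ : ℝ}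
    (hA₁ : gaussAvg β H (fun a => G₁ a ^ 2) ≤ A₁) (hA₂ : gaussAvg β H (fun a => G₂ a ^ 2) ≤ A₂) (hA₃ : gaussAvg β H (fun a => P a ^ 2) ≤ A₃)
    (hA₁₂ : gaussAvg β H (fun a => (G₁ a * G₂ a) ^ 2) ≤ A₁₂) (hA₁₃ : gaussAvg β H (fun a => (G₁ a * P a) ^ 2) ≤ A₁₃)
    (hA₂₃ : gaussAvg β H (fun a => (G₂ a * P a) ^ 2) ≤ A₂₃) (hA₃₃ : gaussAvg β H (fun a => (P a ^ 2) ^ 2) ≤ A₃₃)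
    (hA₁₂₃ : gaussAvg β H (fun a => (G₁ a * G₂ a * P a) ^ 2) ≤ A₁₂₃) (hA₁₃₃ : gaussAvg β H (fun a => (G₁ a * P a ^ 2) ^ 2) ≤ A₁₃₃)
    (hA₂₃₃ : gaussAvg β H (fun a => (G₂ a * P a ^ 2) ^ 2) ≤ A₂₃₃) (hA₁₂₃₃ : gaussAvg β H (fun a => (G₁ a * G₂ a * P a ^ 2) ^ 2) ≤ A₁₂₃₃) :
    |Tilt.tiltCum4 ((((volume : Measure (LandauFree H → E3)).restrict D).withDensity fun a => ENNReal.ofReal (gaussWeight β H a))) P 0 G₁ G₂ -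
        (gaussAvg β H (fun a => G₁ a * G₂ a * P a ^ 2)
          - 2 * gaussAvg β H P * gaussAvg β H (fun a => G₁ a * G₂ a * P a)
          + 2 * gaussAvg β H P ^ 2 * gaussAvg β H (fun a => G₁ a * G₂ a)
          - gaussAvg β H G₁ * gaussAvg β H (fun a => G₂ a * P a ^ 2)
          - gaussAvg β H G₂ * gaussAvg β H (fun a => G₁ a * P a ^ 2)
          + 4 * (gaussAvg β H G₁ * gaussAvg β H P * gaussAvg β H (fun a => G₂ a * P a))
          + 4 * (gaussAvg β H G₂ * gaussAvg β H P * gaussAvg β H (fun a => G₁ a * P a))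
          + 2 * (gaussAvg β H G₁ * gaussAvg β H G₂ * gaussAvg β H (fun a => P a ^ 2))
          - 6 * (gaussAvg β H G₁ * gaussAvg β H G₂ * gaussAvg β H P ^ 2)
          - gaussAvg β H (fun a => G₁ a * G₂ a) * gaussAvg β H (fun a => P a ^ 2)
          - 2 * (gaussAvg β H (fun a => G₁ a * P a) * gaussAvg β H (fun a => G₂ a * P a)))| ≤
      Real.sqrt τ * (4 * Real.sqrt A₁₂₃₃ + 24 * (Real.sqrt A₃ * Real.sqrt A₁₂₃) + 56 * (Real.sqrt A₃ ^ 2 * Real.sqrt A₁₂) +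
        12 * (Real.sqrt A₁ * Real.sqrt A₂₃₃) + 12 * (Real.sqrt A₂ * Real.sqrt A₁₃₃) + 112 * (Real.sqrt A₁ * Real.sqrt A₃ * Real.sqrt A₂₃) +
        112 * (Real.sqrt A₂ * Real.sqrt A₃ * Real.sqrt A₁₃) + 56 * (Real.sqrt A₁ * Real.sqrt A₂ * Real.sqrt A₃₃) +
        360 * (Real.sqrt A₁ * Real.sqrt A₂ * Real.sqrt A₃ ^ 2) + 12 * (Real.sqrt A₁₂ * Real.sqrt A₃₃) + 24 * (Real.sqrt A₁₃ * Real.sqrt A₂₃)) := by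
  -- the D-mass and the instances
  have hD := integral_indicator_mul_gaussWeight_pos hβ hDm hτ hτ2
  haveI := isFiniteMeasure_muSet hβ D
  haveI := neZero_muSet hβ hDm hD
  -- truncations: bounded measurable, a.e. equal to the originals
  have mI : Measurable (D.indicator (fun _ => (1 : ℝ))) := measurable_const.indicator hDm
  have m₁' : Measurable fun a => D.indicator (fun _ => (1 : ℝ)) a * G₁ a := mI.mul h₁
  have m₂' : Measurable fun a => D.indicator (fun _ => (1 : ℝ)) a * G₂ a := mI.mul h₂
  have mP' : Measurable fun a => D.indicator (fun _ => (1 : ℝ)) a * P a := mI.mul hP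
  have b₁' : ∀ a, |D.indicator (fun _ => (1 : ℝ)) a * G₁ a| ≤ B := fun a => abs_indicator_one_mul_le hB h₁D a
  have b₂' : ∀ a, |D.indicator (fun _ => (1 : ℝ)) a * G₂ a| ≤ B := fun a => abs_indicator_one_mul_le hB h₂D a
  have bP' : ∀ a, |D.indicator (fun _ => (1 : ℝ)) a * P a| ≤ B := fun a => abs_indicator_one_mul_le hB hPD a
  have hc := Tilt.tiltCum4_congr_ae (ae_muSet_eq_indicator_mul β hDm P) (ae_muSet_eq_indicator_mul β hDm G₁) (ae_muSet_eq_indicator_mul β hDm G₂) (0 : ℝ)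
  rw [hc, Tilt.tiltCum4_eq_raw mP' m₁' m₂' bP' b₁' b₂' 0]
  simp only [tiltExp_muSet_zero_eq hβ hDm]
  -- the products of truncations are the truncated products
  have e1233 : (fun a => D.indicator (fun _ => (1 : ℝ)) a * (D.indicator (fun _ => (1 : ℝ)) a * G₁ a * (D.indicator (fun _ => (1 : ℝ)) a * G₂ a) *
      (D.indicator (fun _ => (1 : ℝ)) a * P a) ^ 2)) = fun a => D.indicator (fun _ => (1 : ℝ)) a * (G₁ a * G₂ a * P a ^ 2) :=
    indicator_one_mul_congr_on fun a ha => by simp only [indicator_one_mul_eq_on _ ha]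
  have e123 : (fun a => D.indicator (fun _ => (1 : ℝ)) a * (D.indicator (fun _ => (1 : ℝ)) a * G₁ a * (D.indicator (fun _ => (1 : ℝ)) a * G₂ a) *
      (D.indicator (fun _ => (1 : ℝ)) a * P a))) = fun a => D.indicator (fun _ => (1 : ℝ)) a * (G₁ a * G₂ a * P a) :=
    indicator_one_mul_congr_on fun a ha => by simp only [indicator_one_mul_eq_on _ ha]
  have e12 : (fun a => D.indicator (fun _ => (1 : ℝ)) a * (D.indicator (fun _ => (1 : ℝ)) a * G₁ a * (D.indicator (fun _ => (1 : ℝ)) a * G₂ a))) =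
      fun a => D.indicator (fun _ => (1 : ℝ)) a * (G₁ a * G₂ a) :=
    indicator_one_mul_congr_on fun a ha => by simp only [indicator_one_mul_eq_on _ ha]
  have e233 : (fun a => D.indicator (fun _ => (1 : ℝ)) a * (D.indicator (fun _ => (1 : ℝ)) a * G₂ a * (D.indicator (fun _ => (1 : ℝ)) a * P a) ^ 2)) =
      fun a => D.indicator (fun _ => (1 : ℝ)) a * (G₂ a * P a ^ 2) :=
    indicator_one_mul_congr_on fun a ha => by simp only [indicator_one_mul_eq_on _ ha]
  have e133 : (fun a => D.indicator (fun _ => (1 : ℝ)) a * (D.indicator (fun _ => (1 : ℝ)) a * G₁ a * (D.indicator (fun _ => (1 : ℝ)) a * P a) ^ 2)) =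
      fun a => D.indicator (fun _ => (1 : ℝ)) a * (G₁ a * P a ^ 2) :=
    indicator_one_mul_congr_on fun a ha => by simp only [indicator_one_mul_eq_on _ ha]
  have e23 : (fun a => D.indicator (fun _ => (1 : ℝ)) a * (D.indicator (fun _ => (1 : ℝ)) a * G₂ a * (D.indicator (fun _ => (1 : ℝ)) a * P a))) =
      fun a => D.indicator (fun _ => (1 : ℝ)) a * (G₂ a * P a) :=
    indicator_one_mul_congr_on fun a ha => by simp only [indicator_one_mul_eq_on _ ha]
  have e13 : (fun a => D.indicator (fun _ => (1 : ℝ)) a * (D.indicator (fun _ => (1 : ℝ)) a * G₁ a * (D.indicator (fun _ => (1 : ℝ)) a * P a))) =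
      fun a => D.indicator (fun _ => (1 : ℝ)) a * (G₁ a * P a) :=
    indicator_one_mul_congr_on fun a ha => by simp only [indicator_one_mul_eq_on _ ha]
  have e33 : (fun a => D.indicator (fun _ => (1 : ℝ)) a * (D.indicator (fun _ => (1 : ℝ)) a * P a) ^ 2) =
      fun a => D.indicator (fun _ => (1 : ℝ)) a * P a ^ 2 :=
    indicator_one_mul_congr_on fun a ha => by simp only [indicator_one_mul_eq_on _ ha]
  have e1 : (fun a => D.indicator (fun _ => (1 : ℝ)) a * (D.indicator (fun _ => (1 : ℝ)) a * G₁ a)) = fun a => D.indicator (fun _ => (1 : ℝ)) a * G₁ a :=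
    indicator_one_mul_congr_on fun a ha => by simp only [indicator_one_mul_eq_on _ ha]
  have e2 : (fun a => D.indicator (fun _ => (1 : ℝ)) a * (D.indicator (fun _ => (1 : ℝ)) a * G₂ a)) = fun a => D.indicator (fun _ => (1 : ℝ)) a * G₂ a :=
    indicator_one_mul_congr_on fun a ha => by simp only [indicator_one_mul_eq_on _ ha]
  have e3 : (fun a => D.indicator (fun _ => (1 : ℝ)) a * (D.indicator (fun _ => (1 : ℝ)) a * P a)) = fun a => D.indicator (fun _ => (1 : ℝ)) a * P a :=
    indicator_one_mul_congr_on fun a ha => by simp only [indicator_one_mul_eq_on _ ha]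
  rw [e1233, e123, e12, e233, e133, e23, e13, e33, e1, e2, e3]
  -- square-integrability of the eleven monomials
  have hP2 : Measurable fun a => P a ^ 2 := hP.pow_const 2
  have q₁ := integrable_sq_of_eight hβ h₁ i₁
  have q₂ := integrable_sq_of_eight hβ h₂ i₂
  have q₃ := integrable_sq_of_eight hβ hP iP
  have q₁₂ := integrable_sq_mul2_of_eight hβ h₁ h₂ i₁ i₂
  have q₁₃ := integrable_sq_mul2_of_eight hβ h₁ hP i₁ iP
  have q₂₃ := integrable_sq_mul2_of_eight hβ h₂ hP i₂ iP
  have q₃₃ : Integrable (fun a => (P a ^ 2) ^ 2 * gaussWeight β H a) :=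
    (integrable_sq_mul2_of_eight hβ hP hP iP iP).congr (Filter.Eventually.of_forall fun a => by ring)
  have q₁₂₃ := integrable_sq_mul3_of_eight hβ h₁ h₂ hP i₁ i₂ iP
  have q₁₃₃ : Integrable (fun a => (G₁ a * P a ^ 2) ^ 2 * gaussWeight β H a) :=
    (integrable_sq_mul3_of_eight hβ h₁ hP hP i₁ iP iP).congr (Filter.Eventually.of_forall fun a => by ring)
  have q₂₃₃ : Integrable (fun a => (G₂ a * P a ^ 2) ^ 2 * gaussWeight β H a) :=
    (integrable_sq_mul3_of_eight hβ h₂ hP hP i₂ iP iP).congr (Filter.Eventually.of_forall fun a => by ring)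
  have q₁₂₃₃ : Integrable (fun a => (G₁ a * G₂ a * P a ^ 2) ^ 2 * gaussWeight β H a) :=
    (integrable_sq_mul4_mul_gaussWeight hβ h₁ h₂ hP hP i₁ i₂ iP iP).congr (Filter.Eventually.of_forall fun a => by ring)
  -- the transfer of each monomial, and the sizes
  have d₁ := abs_rSet_sub_gaussAvg_le_of_sq_le hβ hDm hτ hτ2 h₁ q₁ hA₁
  have d₂ := abs_rSet_sub_gaussAvg_le_of_sq_le hβ hDm hτ hτ2 h₂ q₂ hA₂
  have d₃ := abs_rSet_sub_gaussAvg_le_of_sq_le hβ hDm hτ hτ2 hP q₃ hA₃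
  have d₁₂ := abs_rSet_sub_gaussAvg_le_of_sq_le hβ hDm hτ hτ2 (h₁.mul h₂) q₁₂ hA₁₂
  have d₁₃ := abs_rSet_sub_gaussAvg_le_of_sq_le hβ hDm hτ hτ2 (h₁.mul hP) q₁₃ hA₁₃
  have d₂₃ := abs_rSet_sub_gaussAvg_le_of_sq_le hβ hDm hτ hτ2 (h₂.mul hP) q₂₃ hA₂₃
  have d₃₃ := abs_rSet_sub_gaussAvg_le_of_sq_le hβ hDm hτ hτ2 hP2 q₃₃ hA₃₃
  have d₁₂₃ := abs_rSet_sub_gaussAvg_le_of_sq_le hβ hDm hτ hτ2 ((h₁.mul h₂).mul hP) q₁₂₃ hA₁₂₃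
  have d₁₃₃ := abs_rSet_sub_gaussAvg_le_of_sq_le hβ hDm hτ hτ2 (h₁.mul hP2) q₁₃₃ hA₁₃₃
  have d₂₃₃ := abs_rSet_sub_gaussAvg_le_of_sq_le hβ hDm hτ hτ2 (h₂.mul hP2) q₂₃₃ hA₂₃₃
  have d₁₂₃₃ := abs_rSet_sub_gaussAvg_le_of_sq_le hβ hDm hτ hτ2 ((h₁.mul h₂).mul hP2) q₁₂₃₃ hA₁₂₃₃
  have b₂ := (abs_rSet_le hβ hDm hτ hτ2 h₂ q₂).trans (mul_le_mul_of_nonneg_left (Real.sqrt_le_sqrt hA₂) (by norm_num))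
  have b₃ := (abs_rSet_le hβ hDm hτ hτ2 hP q₃).trans (mul_le_mul_of_nonneg_left (Real.sqrt_le_sqrt hA₃) (by norm_num))
  have b₁₂ := (abs_rSet_le hβ hDm hτ hτ2 (h₁.mul h₂) q₁₂).trans (mul_le_mul_of_nonneg_left (Real.sqrt_le_sqrt hA₁₂) (by norm_num))
  have b₁₃ := (abs_rSet_le hβ hDm hτ hτ2 (h₁.mul hP) q₁₃).trans (mul_le_mul_of_nonneg_left (Real.sqrt_le_sqrt hA₁₃) (by norm_num))
  have b₂₃ := (abs_rSet_le hβ hDm hτ hτ2 (h₂.mul hP) q₂₃).trans (mul_le_mul_of_nonneg_left (Real.sqrt_le_sqrt hA₂₃) (by norm_num))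
  have b₃₃ := (abs_rSet_le hβ hDm hτ hτ2 hP2 q₃₃).trans (mul_le_mul_of_nonneg_left (Real.sqrt_le_sqrt hA₃₃) (by norm_num))
  have b₁₂₃ := (abs_rSet_le hβ hDm hτ hτ2 ((h₁.mul h₂).mul hP) q₁₂₃).trans (mul_le_mul_of_nonneg_left (Real.sqrt_le_sqrt hA₁₂₃) (by norm_num))
  have b₁₃₃ := (abs_rSet_le hβ hDm hτ hτ2 (h₁.mul hP2) q₁₃₃).trans (mul_le_mul_of_nonneg_left (Real.sqrt_le_sqrt hA₁₃₃) (by norm_num))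
  have b₂₃₃ := (abs_rSet_le hβ hDm hτ hτ2 (h₂.mul hP2) q₂₃₃).trans (mul_le_mul_of_nonneg_left (Real.sqrt_le_sqrt hA₂₃₃) (by norm_num))
  have c₁ := (abs_gaussAvg_le_sqrt_sq hβ h₁ q₁).trans (Real.sqrt_le_sqrt hA₁)
  have c₂ := (abs_gaussAvg_le_sqrt_sq hβ h₂ q₂).trans (Real.sqrt_le_sqrt hA₂)
  have c₃ := (abs_gaussAvg_le_sqrt_sq hβ hP q₃).trans (Real.sqrt_le_sqrt hA₃)
  have c₁₂ := (abs_gaussAvg_le_sqrt_sq hβ (h₁.mul h₂) q₁₂).trans (Real.sqrt_le_sqrt hA₁₂)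
  have c₁₃ := (abs_gaussAvg_le_sqrt_sq hβ (h₁.mul hP) q₁₃).trans (Real.sqrt_le_sqrt hA₁₃)
  exact cum4_transfer_arith d₁ d₂ d₃ d₁₂ d₁₃ d₂₃ d₃₃ d₁₂₃ d₁₃₃ d₂₃₃ d₁₂₃₃ b₂ b₃ b₁₂ b₁₃ b₂₃ b₃₃ b₁₂₃ b₁₃₃ b₂₃₃
    c₁ c₂ c₃ c₁₂ c₁₃

/-! ## Re-centring at the full Gaussian means: the CENTRED form -/

/-- **Shift invariance of `κ₄,₀` over `μ_D`** for observables bounded on `D` (any constants; `0 < ∫ 1_D·gaussWeight`). -/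
theorem tiltCum4_muSet_zero_shift (hβ : 0 < β) {D : Set (LandauFree H → E3)} (hDm : MeasurableSet D)
    (hD : 0 < ∫ a, D.indicator (fun _ => (1 : ℝ)) a * gaussWeight β H a)
    {G₁ G₂ P : (LandauFree H → E3) → ℝ} (h₁ : Measurable G₁) (h₂ : Measurable G₂) (hP : Measurable P) {B : ℝ} (hB : 0 ≤ B)
    (h₁D : ∀ a ∈ D, |G₁ a| ≤ B) (h₂D : ∀ a ∈ D, |G₂ a| ≤ B) (hPD : ∀ a ∈ D, |P a| ≤ B) (c₁ c₂ c₃ : ℝ) :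
    Tilt.tiltCum4 ((((volume : Measure (LandauFree H → E3)).restrict D).withDensity fun a => ENNReal.ofReal (gaussWeight β H a))) P 0 G₁ G₂ =
      Tilt.tiltCum4 ((((volume : Measure (LandauFree H → E3)).restrict D).withDensity fun a => ENNReal.ofReal (gaussWeight β H a)))
        (fun a => P a - c₃) 0 (fun a => G₁ a - c₁) (fun a => G₂ a - c₂) := by
  haveI := isFiniteMeasure_muSet hβ D
  haveI := neZero_muSet hβ hDm hD
  have mI : Measurable (D.indicator (fun _ => (1 : ℝ))) := measurable_const.indicator hDm
  have m₁' : Measurable fun a => D.indicator (fun _ => (1 : ℝ)) a * G₁ a := mI.mul h₁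
  have m₂' : Measurable fun a => D.indicator (fun _ => (1 : ℝ)) a * G₂ a := mI.mul h₂
  have mP' : Measurable fun a => D.indicator (fun _ => (1 : ℝ)) a * P a := mI.mul hP
  have b₁' : ∀ a, |D.indicator (fun _ => (1 : ℝ)) a * G₁ a| ≤ B := fun a => abs_indicator_one_mul_le hB h₁D a
  have b₂' : ∀ a, |D.indicator (fun _ => (1 : ℝ)) a * G₂ a| ≤ B := fun a => abs_indicator_one_mul_le hB h₂D a
  have bP' : ∀ a, |D.indicator (fun _ => (1 : ℝ)) a * P a| ≤ B := fun a => abs_indicator_one_mul_le hB hPD a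
  have hL := Tilt.tiltCum4_congr_ae (ae_muSet_eq_indicator_mul β hDm P) (ae_muSet_eq_indicator_mul β hDm G₁) (ae_muSet_eq_indicator_mul β hDm G₂) (0 : ℝ)
  have aP : (fun a => P a - c₃) =ᵐ[(((volume : Measure (LandauFree H → E3)).restrict D).withDensity fun a => ENNReal.ofReal (gaussWeight β H a))]
      fun a => D.indicator (fun _ => (1 : ℝ)) a * P a - c₃ := by
    filter_upwards [ae_muSet_mem β hDm] with a ha
    rw [indicator_one_mul_eq_on P ha]
  have a₁ : (fun a => G₁ a - c₁) =ᵐ[(((volume : Measure (LandauFree H → E3)).restrict D).withDensity fun a => ENNReal.ofReal (gaussWeight β H a))]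
      fun a => D.indicator (fun _ => (1 : ℝ)) a * G₁ a - c₁ := by
    filter_upwards [ae_muSet_mem β hDm] with a ha
    rw [indicator_one_mul_eq_on G₁ ha]
  have a₂ : (fun a => G₂ a - c₂) =ᵐ[(((volume : Measure (LandauFree H → E3)).restrict D).withDensity fun a => ENNReal.ofReal (gaussWeight β H a))]
      fun a => D.indicator (fun _ => (1 : ℝ)) a * G₂ a - c₂ := by
    filter_upwards [ae_muSet_mem β hDm] with a ha
    rw [indicator_one_mul_eq_on G₂ ha]
  have hR := Tilt.tiltCum4_congr_ae aP a₁ a₂ (0 : ℝ)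
  rw [hL, hR, Tilt.tiltCum4_shiftU mP' bP' c₃ 0, Tilt.tiltCum4_shift mP' m₁' m₂' bP' b₁' b₂' c₁ c₂ 0]

/-- ★★ **D-TRUNCATION TRANSFER FOR `κ₄,₀`, CENTRED FORM** (`X̃ = G₁ − E₀G₁`, `Ỹ = G₂ − E₀G₂`, `Z̃ = P − E₀P`; sizes of the CENTRED monomials):
`|Tilt.tiltCum4 μ_D P 0 G₁ G₂ − (E₀[X̃ỸZ̃²] − E₀[X̃Ỹ]·E₀[Z̃²] − 2·E₀[X̃Z̃]·E₀[ỸZ̃])| ≤ √τ·(the eleven-term size polynomial)`. -/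
theorem abs_tiltCum4_muSet_zero_sub_gaussAvg_centred_le (hβ : 0 < β) {D : Set (LandauFree H → E3)} (hDm : MeasurableSet D) {τ : ℝ}
    (hτ : gaussAvg β H (fun a => 1 - D.indicator (fun _ => (1 : ℝ)) a) ≤ τ) (hτ2 : τ ≤ 1 / 2)
    {G₁ G₂ P : (LandauFree H → E3) → ℝ} (h₁ : Measurable G₁) (h₂ : Measurable G₂) (hP : Measurable P) {B : ℝ} (hB : 0 ≤ B)
    (h₁D : ∀ a ∈ D, |G₁ a| ≤ B) (h₂D : ∀ a ∈ D, |G₂ a| ≤ B) (hPD : ∀ a ∈ D, |P a| ≤ B)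
    (i₁ : Integrable (fun a => G₁ a ^ 8 * gaussWeight β H a)) (i₂ : Integrable (fun a => G₂ a ^ 8 * gaussWeight β H a))
    (iP : Integrable (fun a => P a ^ 8 * gaussWeight β H a))
    {A₁ A₂ A₃ A₁₂ A₁₃ A₂₃ A₃₃ A₁₂₃ A₁₃₃ A₂₃₃ A₁₂₃₃ : ℝ}
    (hA₁ : gaussAvg β H (fun a => (G₁ a - gaussAvg β H G₁) ^ 2) ≤ A₁) (hA₂ : gaussAvg β H (fun a => (G₂ a - gaussAvg β H G₂) ^ 2) ≤ A₂)
    (hA₃ : gaussAvg β H (fun a => (P a - gaussAvg β H P) ^ 2) ≤ A₃)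
    (hA₁₂ : gaussAvg β H (fun a => ((G₁ a - gaussAvg β H G₁) * (G₂ a - gaussAvg β H G₂)) ^ 2) ≤ A₁₂)
    (hA₁₃ : gaussAvg β H (fun a => ((G₁ a - gaussAvg β H G₁) * (P a - gaussAvg β H P)) ^ 2) ≤ A₁₃)
    (hA₂₃ : gaussAvg β H (fun a => ((G₂ a - gaussAvg β H G₂) * (P a - gaussAvg β H P)) ^ 2) ≤ A₂₃)
    (hA₃₃ : gaussAvg β H (fun a => ((P a - gaussAvg β H P) ^ 2) ^ 2) ≤ A₃₃)
    (hA₁₂₃ : gaussAvg β H (fun a => ((G₁ a - gaussAvg β H G₁) * (G₂ a - gaussAvg β H G₂) * (P a - gaussAvg β H P)) ^ 2) ≤ A₁₂₃)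
    (hA₁₃₃ : gaussAvg β H (fun a => ((G₁ a - gaussAvg β H G₁) * (P a - gaussAvg β H P) ^ 2) ^ 2) ≤ A₁₃₃)
    (hA₂₃₃ : gaussAvg β H (fun a => ((G₂ a - gaussAvg β H G₂) * (P a - gaussAvg β H P) ^ 2) ^ 2) ≤ A₂₃₃)
    (hA₁₂₃₃ : gaussAvg β H (fun a => ((G₁ a - gaussAvg β H G₁) * (G₂ a - gaussAvg β H G₂) * (P a - gaussAvg β H P) ^ 2) ^ 2) ≤ A₁₂₃₃) :
    |Tilt.tiltCum4 ((((volume : Measure (LandauFree H → E3)).restrict D).withDensity fun a => ENNReal.ofReal (gaussWeight β H a))) P 0 G₁ G₂ -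
        (gaussAvg β H (fun a => (G₁ a - gaussAvg β H G₁) * (G₂ a - gaussAvg β H G₂) * (P a - gaussAvg β H P) ^ 2)
          - gaussAvg β H (fun a => (G₁ a - gaussAvg β H G₁) * (G₂ a - gaussAvg β H G₂)) * gaussAvg β H (fun a => (P a - gaussAvg β H P) ^ 2)
          - 2 * (gaussAvg β H (fun a => (G₁ a - gaussAvg β H G₁) * (P a - gaussAvg β H P)) *
              gaussAvg β H (fun a => (G₂ a - gaussAvg β H G₂) * (P a - gaussAvg β H P))))| ≤
      Real.sqrt τ * (4 * Real.sqrt A₁₂₃₃ + 24 * (Real.sqrt A₃ * Real.sqrt A₁₂₃) + 56 * (Real.sqrt A₃ ^ 2 * Real.sqrt A₁₂) +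
        12 * (Real.sqrt A₁ * Real.sqrt A₂₃₃) + 12 * (Real.sqrt A₂ * Real.sqrt A₁₃₃) + 112 * (Real.sqrt A₁ * Real.sqrt A₃ * Real.sqrt A₂₃) +
        112 * (Real.sqrt A₂ * Real.sqrt A₃ * Real.sqrt A₁₃) + 56 * (Real.sqrt A₁ * Real.sqrt A₂ * Real.sqrt A₃₃) +
        360 * (Real.sqrt A₁ * Real.sqrt A₂ * Real.sqrt A₃ ^ 2) + 12 * (Real.sqrt A₁₂ * Real.sqrt A₃₃) + 24 * (Real.sqrt A₁₃ * Real.sqrt A₂₃)) := by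
  have hD := integral_indicator_mul_gaussWeight_pos hβ hDm hτ hτ2
  set m₁ := gaussAvg β H G₁ with hm₁
  set m₂ := gaussAvg β H G₂ with hm₂
  set b := gaussAvg β H P with hb
  rw [tiltCum4_muSet_zero_shift hβ hDm hD h₁ h₂ hP hB h₁D h₂D hPD m₁ m₂ b]
  have hX : Measurable fun a => G₁ a - m₁ := h₁.sub measurable_const
  have hY : Measurable fun a => G₂ a - m₂ := h₂.sub measurable_const
  have hZ : Measurable fun a => P a - b := hP.sub measurable_const
  have hB' : 0 ≤ B + (|m₁| + |m₂| + |b|) := by positivity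
  have hXD : ∀ a ∈ D, |G₁ a - m₁| ≤ B + (|m₁| + |m₂| + |b|) := fun a ha =>
    (abs_sub _ _).trans (by linarith [h₁D a ha, abs_nonneg m₂, abs_nonneg b])
  have hYD : ∀ a ∈ D, |G₂ a - m₂| ≤ B + (|m₁| + |m₂| + |b|) := fun a ha =>
    (abs_sub _ _).trans (by linarith [h₂D a ha, abs_nonneg m₁, abs_nonneg b])
  have hZD : ∀ a ∈ D, |P a - b| ≤ B + (|m₁| + |m₂| + |b|) := fun a ha =>
    (abs_sub _ _).trans (by linarith [hPD a ha, abs_nonneg m₁, abs_nonneg m₂])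
  have iX := integrable_sub_const_pow_eight_mul_gaussWeight hβ h₁ i₁ m₁
  have iY := integrable_sub_const_pow_eight_mul_gaussWeight hβ h₂ i₂ m₂
  have iZ := integrable_sub_const_pow_eight_mul_gaussWeight hβ hP iP b
  have key := abs_tiltCum4_muSet_zero_sub_gaussCum4_le hβ hDm hτ hτ2 hX hY hZ hB' hXD hYD hZD iX iY iZ
    hA₁ hA₂ hA₃ hA₁₂ hA₁₃ hA₂₃ hA₃₃ hA₁₂₃ hA₁₃₃ hA₂₃₃ hA₁₂₃₃
  -- the centred slots have zero mean
  have z₁ : gaussAvg β H (fun a => G₁ a - m₁) = 0 := gaussAvg_sub_gaussAvg_eq_zero hβ h₁ (integrable_sq_of_eight hβ h₁ i₁)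
  have z₂ : gaussAvg β H (fun a => G₂ a - m₂) = 0 := gaussAvg_sub_gaussAvg_eq_zero hβ h₂ (integrable_sq_of_eight hβ h₂ i₂)
  have z₃ : gaussAvg β H (fun a => P a - b) = 0 := gaussAvg_sub_gaussAvg_eq_zero hβ hP (integrable_sq_of_eight hβ hP iP)
  simp only [z₁, z₂, z₃, zero_mul, mul_zero, sub_zero, add_zero, ne_eq, OfNat.ofNat_ne_zero, not_false_eq_true, zero_pow] at key
  exact key

end GaussRestrict

end Summit.QuantumFields.YangMills.Theorems.AllWindowsColdBoxBoxHighLine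

end
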